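import Summits.KontsevichZagierPeriods.KontsevichZagierPeriods.Theorems.FurushoPentagonDoubleShuffleInKZOhnoSeries
import Literature.NumberTheory.Transcendental.MZVShuffleRegularisation

/-!
# `DoubleShuffleInKZ` (stmt-KontsevichZagierPeriods-14665, route `FurushoPentagon`) ⟸ Ohno's relations, III:
# pairing with a functional — Ohno's sums are the graded pieces of `σ`, duality is `τ`

Helper file (`--supports stmt-KontsevichZagierPeriods-14665`), continuing `…OhnoSeries.lean`.
A "functional" is any `ψ : {binary words} → M` into a `ℚ`-module; its weight-`n` pairing with a
series `φ ∈ ℚ⟨⟨x,y⟩⟩` is `⟨φ, ψ⟩_n = Σ_{|w| = n} c_w(φ) ψ(w)` (written out, no definition).  Proved: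

* `pair_sigma_binaryWord` — **Ohno's sums are the graded pieces of IKZ's `σ`**:
  `⟨σ(w_s), ψ⟩_{|s|+m} = (-1)^m Σ_{u ∈ Z(s;m)} ψ(w_u)` with `Z(s; m) = MZV.ohnoIndices s m`
  ([IharaKanekoZagier2006, §6]: `σ_m(x^{k₁-1}y⋯x^{k_n-1}y) = Σ_{e₁+⋯+e_n=m} x^{k₁+e₁-1}y ⋯`;
  [Ohno1999, Thm 1]); the recursion of `ohnoIndices` on the first entry is the geometric series
  `(1+x)^{-1} = 1 - x(1+x)^{-1}` (`pair_geom_recursion`);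
* `pair_dualSeries` — `⟨τ φ, ψ⟩_n = ⟨φ, ψ ∘ τ⟩_n` (reindex by the involution), and hence
  (`pair_dualSeries_of_dual`) `= ⟨φ, ψ⟩_n` when `ψ` is DUALITY-invariant on convergent words and `φ`
  lives on convergent words;
* `subst_monomial_apply_eq_zero_of_not_convergent` — the images `σ(w)`, `σ̄(w)`, `Δ(w)`, `ρ(w)` of
  a convergent word live on convergent words (each substitution sends `x ↦ x·(…)`, `y ↦ (…)·y`).

References: K. Ihara, M. Kaneko, D. Zagier, Compositio Math. 142 (2006), §6; Y. Ohno, J. Number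
Theory 74 (1999), Thm 1.
-/

noncomputable section

open scoped BigOperators
open Literature.NumberTheory.Transcendental NCSeries IKZ

namespace Summit.KontsevichZagierPeriods.FurushoPentagon.DoubleShuffleInKZ

variable {M : Type} [AddCommGroup M] [Module ℚ M]

/-! ## 1. Re-indexing the pairing: prefixes and the involution `τ` -/

/-- **Prefix re-indexing**: `Σ_{|w| = |p|+n} [p <+: w] c(w minus p) ψ(w) = Σ_{|w'| = n} c(w') ψ(p w')`.
[folklore] -/
theorem sum_words_prefix (p : List Bool) (n : ℕ) (c : List Bool → ℚ) (ψ : List Bool → M) :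
    ∑ w ∈ wordsOfLength Bool (p.length + n), (if p <+: w then c (w.drop p.length) else 0) • ψ w =
      ∑ w ∈ wordsOfLength Bool n, c w • ψ (p ++ w) := by
  have h1 : ∀ w ∈ wordsOfLength Bool (p.length + n), (if p <+: w then c (w.drop p.length) else 0) • ψ w =
      if p <+: w then c (w.drop p.length) • ψ w else 0 := fun w _ => by
    split_ifs <;> simp
  rw [Finset.sum_congr rfl h1, ← Finset.sum_filter]
  have hset : (wordsOfLength Bool (p.length + n)).filter (fun w => p <+: w) =
      (wordsOfLength Bool n).image fun w => p ++ w := by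
    ext w
    simp only [Finset.mem_filter, mem_wordsOfLength, Finset.mem_image]
    constructor
    · rintro ⟨hl, t, rfl⟩
      refine ⟨t, ?_, rfl⟩
      rw [List.length_append] at hl; omega
    · rintro ⟨t, ht, rfl⟩
      exact ⟨by rw [List.length_append, ht], List.prefix_append p t⟩
  rw [hset, Finset.sum_image fun u _ v _ h => List.append_cancel_left h]
  exact Finset.sum_congr rfl fun w _ => by rw [List.drop_left]

/-- **`⟨τ φ, ψ⟩_n = ⟨φ, ψ ∘ τ⟩_n`**: re-index by the involution `τ` (reverse and exchange letters).
[cite: IharaKanekoZagier2006, §6 (τ)] -/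
theorem pair_dualSeries (φ : NCSeries Bool ℚ) (ψ : List Bool → M) (n : ℕ) :
    ∑ w ∈ wordsOfLength Bool n, dualSeries (fun b => !b) φ w • ψ w =
      ∑ w ∈ wordsOfLength Bool n, φ w • ψ ((w.reverse).map fun b => !b) := by
  refine Finset.sum_nbij' (fun w => (w.reverse).map fun b => !b) (fun w => (w.reverse).map fun b => !b)
    ?_ ?_ ?_ ?_ ?_
  · intro w hw; rw [mem_wordsOfLength] at hw ⊢; simp [hw]
  · intro w hw; rw [mem_wordsOfLength] at hw ⊢; simp [hw]
  · intro w _; simp [List.map_reverse, List.map_map, Function.comp_def]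
  · intro w _; simp [List.map_reverse, List.map_map, Function.comp_def]
  · intro w _
    rw [dualSeries_apply]
    congr 2
    simp [List.map_reverse, List.map_map, Function.comp_def]

/-- **Duality**: if `ψ(τ v) = ψ(v)` on convergent words and `φ` lives on convergent words in weight
`n`, then `⟨τ φ, ψ⟩_n = ⟨φ, ψ⟩_n`. [cite: IharaKanekoZagier2006, §6 (Z((1 - τ)w₀) = 0)] -/
theorem pair_dualSeries_of_dual (φ : NCSeries Bool ℚ) (ψ : List Bool → M) (n : ℕ)
    (hdual : ∀ v : List Bool, MZV.IsConvergentWord v → ψ ((v.reverse).map fun b => !b) = ψ v)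
    (hφ : ∀ v : List Bool, v.length = n → ¬ MZV.IsConvergentWord v → φ v = 0) :
    ∑ w ∈ wordsOfLength Bool n, dualSeries (fun b => !b) φ w • ψ w =
      ∑ w ∈ wordsOfLength Bool n, φ w • ψ w := by
  rw [pair_dualSeries]
  refine Finset.sum_congr rfl fun w hw => ?_
  rw [mem_wordsOfLength] at hw
  by_cases hc : MZV.IsConvergentWord w
  · rw [hdual w hc]
  · rw [hφ w hw hc, zero_smul, zero_smul]

/-! ## 2. Supports: substitutions `x ↦ x·A`, `y ↦ B·y` preserve `x 𝔥 y` -/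

/-- A word is convergent and nonempty iff it starts with `x` and ends with `y`. [folklore] -/
theorem isConvergentWord_of_head_of_getLast {v : List Bool} (h1 : v.head? = some false)
    (h2 : v.getLast? = some true) : MZV.IsConvergentWord v :=
  Or.inr ⟨h1, h2⟩

/-- **Images of convergent words live on convergent words**: if `f x = x·A` and `f y = B·y`, then for
a nonempty convergent word `w` (starts with `x`, ends with `y`), `c_v(w(f)) ≠ 0` only for `v`
starting with `x` and ending with `y`. [folklore] -/
theorem subst_monomial_apply_eq_zero_of_not_convergent {f : Bool → NCSeries Bool ℚ}
    (hf : ∀ a, f a [] = 0) {A B : NCSeries Bool ℚ} (hx : f false = letter false * A)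
    (hy : f true = B * letter true) {w : List Bool} (hw1 : w.head? = some false)
    (hw2 : w.getLast? = some true) (v : List Bool) (hv : ¬ MZV.IsConvergentWord v) :
    subst f (monomial w 1) v = 0 := by
  -- `w = x :: w'` and `w = w'' ++ [y]`
  obtain ⟨w', rfl⟩ : ∃ w', w = false :: w' := by
    cases w with
    | nil => simp at hw1
    | cons a w' => simp only [List.head?_cons, Option.some.injEq] at hw1; exact ⟨w', by rw [hw1]⟩
  have hstart : ∀ u : List Bool, u.head? ≠ some false → subst f (monomial (false :: w') 1) u = 0 := by
    intro u hu
    rw [subst_monomial_cons hf, hx, mul_assoc]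
    cases u with
    | nil => exact letter_mul_apply_nil _ _
    | cons b u =>
      rw [letter_mul_apply_cons, if_neg]
      intro hb; apply hu; rw [hb]; rfl
  obtain ⟨w'', hw''⟩ : ∃ w'', false :: w' = w'' ++ [true] := by
    rw [List.getLast?_eq_some_iff] at hw2
    obtain ⟨w'', h⟩ := hw2
    exact ⟨w'', h⟩
  have hend : ∀ u : List Bool, u.getLast? ≠ some true → subst f (monomial (false :: w') 1) u = 0 := by
    intro u hu
    rw [hw'', subst_monomial_append hf, show (monomial [true] 1 : NCSeries Bool ℚ) = letter true from rfl,
      subst_letter hf, hy, ← mul_assoc, mul_letter_apply, if_neg hu]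
  by_cases h1 : v.head? = some false
  · by_cases h2 : v.getLast? = some true
    · exact absurd (isConvergentWord_of_head_of_getLast h1 h2) hv
    · exact hend v h2
  · exact hstart v h1

/-- `σ(w)` of a nonempty convergent word lives on convergent words.
[cite: IharaKanekoZagier2006, §6 (σ preserves 𝔥⁰)] -/
theorem sigma_monomial_apply_eq_zero_of_not_convergent {w : List Bool} (hw1 : w.head? = some false)
    (hw2 : w.getLast? = some true) (v : List Bool) (hv : ¬ MZV.IsConvergentWord v) :
    subst sigmaSub (monomial w 1 : NCSeries Bool ℚ) v = 0 :=
  subst_monomial_apply_eq_zero_of_not_convergent sigmaSub_apply_nil (A := 1) (B := geom false (-1))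
    (by rw [mul_one]; rfl) rfl hw1 hw2 v hv

/-- `σ̄(w)` of a nonempty convergent word lives on convergent words.
[cite: IharaKanekoZagier2006, §6 (σ̄ preserves 𝔥⁰)] -/
theorem sigmaBar_monomial_apply_eq_zero_of_not_convergent {w : List Bool} (hw1 : w.head? = some false)
    (hw2 : w.getLast? = some true) (v : List Bool) (hv : ¬ MZV.IsConvergentWord v) :
    subst sigmaBarSub (monomial w 1 : NCSeries Bool ℚ) v = 0 :=
  subst_monomial_apply_eq_zero_of_not_convergent sigmaBarSub_apply_nil (A := geom true (-1)) (B := 1)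
    rfl (by rw [one_mul]; rfl) hw1 hw2 v hv

/-- `Δ(w)` of a nonempty convergent word lives on convergent words.
[cite: IharaKanekoZagier2006, Cor. 3 (Δ_u preserves 𝔥⁰)] -/
theorem delta_monomial_apply_eq_zero_of_not_convergent {w : List Bool} (hw1 : w.head? = some false)
    (hw2 : w.getLast? = some true) (v : List Bool) (hv : ¬ MZV.IsConvergentWord v) :
    subst deltaSub (monomial w 1 : NCSeries Bool ℚ) v = 0 :=
  subst_monomial_apply_eq_zero_of_not_convergent deltaSub_apply_nil (A := geom true (-1))
    (B := 1 + letter false * geom true (-1)) rfl rfl hw1 hw2 v hv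

/-- `ρ(w)` of a nonempty convergent word lives on convergent words.
[cite: IharaKanekoZagier2006, §6 (σ preserves 𝔥⁰)] -/
theorem rho_monomial_apply_eq_zero_of_not_convergent {w : List Bool} (hw1 : w.head? = some false)
    (hw2 : w.getLast? = some true) (v : List Bool) (hv : ¬ MZV.IsConvergentWord v) :
    subst rhoSub (monomial w 1 : NCSeries Bool ℚ) v = 0 :=
  subst_monomial_apply_eq_zero_of_not_convergent rhoSub_apply_nil (A := 1) (B := 1 + letter false)
    (by rw [mul_one]; rfl) rfl hw1 hw2 v hv

/-! ## 3. Ohno's sums are the graded pieces of `σ` -/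

/-- A substituted monomial vanishes on words shorter than the monomial (constant-term-free letter
images). [folklore] -/
theorem subst_monomial_apply_eq_zero_of_length_lt {f : Bool → NCSeries Bool ℚ} (hf : ∀ a, f a [] = 0)
    (w v : List Bool) (h : v.length < w.length) : subst f (monomial w 1) v = 0 := by
  rw [subst_monomial hf, one_smul, prod_map_apply_eq_zero hf h]

/-- If `φ` vanishes below length `L`, so does `ψ φ`. [folklore] -/
theorem mul_apply_eq_zero_of_right_lt {φ : NCSeries Bool ℚ} (ψ : NCSeries Bool ℚ) {L : ℕ}
    (hφ : ∀ v : List Bool, v.length < L → φ v = 0) (v : List Bool) (hv : v.length < L) : (ψ * φ) v = 0 := by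
  rw [mul_apply]
  refine Finset.sum_eq_zero fun c hc => ?_
  have hl := congrArg List.length (mem_splits.mp hc)
  rw [List.length_append] at hl
  rw [hφ c.2 (by omega), mul_zero]

/-- `x` commutes with the geometric series in `x`. [folklore] -/
theorem pow_x_mul_geom_comm (c : ℚ) : ∀ k : ℕ,
    (letter false : NCSeries Bool ℚ) ^ k * geom false c = geom false c * letter false ^ k
  | 0 => by rw [pow_zero, one_mul, mul_one]
  | k + 1 => by
    have h1 : (letter false : NCSeries Bool ℚ) * geom false c = geom false c * letter false := by
      have e1 := geom_eq_one_add false c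
      have e2 := geom_eq_one_add' false c
      rcases eq_or_ne c 0 with rfl | hc
      · -- `geom a 0 = 1`
        have : geom false (0 : ℚ) = 1 := by rw [e1, zero_smul, add_zero]
        rw [this, mul_one, one_mul]
      · have h := e1.symm.trans e2
        rw [add_right_inj] at h
        exact smul_right_injective _ hc h
    rw [pow_succ, mul_assoc, h1, ← mul_assoc, pow_x_mul_geom_comm c k, mul_assoc]

/-- `Σ_{i < n} f i` over `Finset.range` as a list sum over `List.range`. [folklore] -/
theorem finset_sum_range_eq_list_sum {N : Type*} [AddCommMonoid N] (f : ℕ → N) : ∀ n : ℕ,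
    ∑ i ∈ Finset.range n, f i = ((List.range n).map f).sum
  | 0 => by simp
  | n + 1 => by rw [Finset.sum_range_succ, finset_sum_range_eq_list_sum f n, List.range_succ]; simp

/-- `Σ` through `flatMap`. [folklore] -/
theorem sum_map_flatMap {N : Type*} [AddCommMonoid N] {α β : Type*} (g : β → N) (f : α → List β) :
    ∀ L : List α, ((L.flatMap f).map g).sum = (L.map fun a => ((f a).map g).sum).sum
  | [] => by simp
  | a :: L => by rw [List.flatMap_cons, List.map_append, List.sum_append, sum_map_flatMap g f L]; rfl

/-- **The geometric-series recursion of the Ohno block** `x^k (1+x)^{-1} y`: paired against any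
functional in weight `k + 1 + L + m`, for `Φ` vanishing below weight `L`,
`⟨x^k (1+x)^{-1} y Φ, ψ⟩ = Σ_{j ≤ m} (-1)^j ⟨Φ, ψ(x^{k+j} y ·)⟩_{L+m-j}` — the terms `j > m` die
below the weight of `Φ`. [cite: IharaKanekoZagier2006, §6 (σ(y) = (1-x)⁻¹y)] -/
theorem pair_geom_block (Φ : NCSeries Bool ℚ) {L : ℕ} (hΦ : ∀ v : List Bool, v.length < L → Φ v = 0)
    (ψ : List Bool → M) : ∀ (m k : ℕ),
    ∑ w ∈ wordsOfLength Bool (k + 1 + L + m),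
        ((letter false : NCSeries Bool ℚ) ^ k * (geom false (-1) * letter true) * Φ : NCSeries Bool ℚ) w • ψ w =
      ∑ j ∈ Finset.range (m + 1), (-1 : ℚ) ^ j •
        ∑ w ∈ wordsOfLength Bool (L + (m - j)), Φ w • ψ (List.replicate (k + j) false ++ [true] ++ w) := by
  -- the recursion `x^k G₀ y Φ = x^k y Φ - x^{k+1} G₀ y Φ`
  have hrec : ∀ k : ℕ, ((letter false : NCSeries Bool ℚ) ^ k * (geom false (-1) * letter true) * Φ) =
      letter false ^ k * letter true * Φ - letter false ^ (k + 1) * (geom false (-1) * letter true) * Φ := by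
    intro k
    conv_lhs => rw [geom_eq_one_add false (-1 : ℚ)]
    rw [neg_one_smul, pow_succ]
    noncomm_ring
  -- vanishing below the weight `k + 1 + L`
  have hvan : ∀ (k : ℕ) (v : List Bool), v.length < k + 1 + L →
      ((letter false : NCSeries Bool ℚ) ^ k * (geom false (-1) * letter true) * Φ : NCSeries Bool ℚ) v = 0 := by
    intro k v hv
    rw [← mul_assoc, pow_x_mul_geom_comm, mul_assoc, mul_assoc, ← mul_assoc (letter false ^ k)]
    refine mul_apply_eq_zero_of_right_lt _ (L := k + 1 + L) (fun u hu => ?_) v hv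
    rw [pow_x_mul_y_mul_apply]
    split_ifs with hp
    · exact hΦ _ (by have := hp.length_le; simp at this; rw [List.length_drop]; omega)
    · rfl
  -- the head term re-indexed by the prefix `x^k y`
  have hhead : ∀ (k n : ℕ), ∑ w ∈ wordsOfLength Bool (k + 1 + n),
      ((letter false : NCSeries Bool ℚ) ^ k * letter true * Φ : NCSeries Bool ℚ) w • ψ w =
      ∑ w ∈ wordsOfLength Bool n, Φ w • ψ (List.replicate k false ++ [true] ++ w) := by
    intro k n
    have hl : (List.replicate k false ++ [true]).length = k + 1 := by simp
    rw [← hl, ← sum_words_prefix (List.replicate k false ++ [true]) n Φ ψ, hl]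
    exact Finset.sum_congr rfl fun w _ => by rw [pow_x_mul_y_mul_apply]
  intro m
  induction m with
  | zero =>
    intro k
    rw [Finset.sum_range_one, pow_zero, one_smul, Nat.sub_zero, add_zero, hrec k]
    simp only [NCSeries.sub_apply, sub_smul, Finset.sum_sub_distrib, add_zero]
    have hB : ∑ x ∈ wordsOfLength Bool (k + 1 + L),
        ((letter false : NCSeries Bool ℚ) ^ (k + 1) * (geom false (-1) * letter true) * Φ : NCSeries Bool ℚ) x •
          ψ x = 0 := Finset.sum_eq_zero fun w hw => by
      rw [mem_wordsOfLength] at hw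
      rw [hvan (k + 1) w (by omega), zero_smul]
    rw [hhead k L, hB, sub_zero]
  | succ m ih =>
    intro k
    rw [hrec k]
    simp only [NCSeries.sub_apply, sub_smul, Finset.sum_sub_distrib]
    rw [show k + 1 + L + (m + 1) = k + 1 + (L + (m + 1)) by ring, hhead k,
      show k + 1 + (L + (m + 1)) = (k + 1) + 1 + L + m by ring, ih (k + 1), Finset.sum_range_succ' _ (m + 1)]
    simp only [pow_zero, one_smul, Nat.sub_zero, add_zero, pow_succ, mul_neg, mul_one, neg_smul,
      Finset.sum_neg_distrib, Nat.succ_sub_succ_eq_sub]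
    rw [sub_eq_add_neg, add_comm]
    congr 1
    refine congrArg Neg.neg (Finset.sum_congr rfl fun j _ => ?_)
    rw [show k + 1 + j = k + (j + 1) by ring]

/-- `x^{a-1+j} y ++ w_u = w_{(a+j) :: u}` for `a ≥ 1`. [folklore] -/
theorem replicate_append_binaryWord {a : ℕ} (ha : 1 ≤ a) (j : ℕ) (u : List ℕ) :
    List.replicate (a - 1 + j) false ++ [true] ++ MZV.binaryWord u = MZV.binaryWord ((a + j) :: u) := by
  rw [MZV.binaryWord, show a + j - 1 = a - 1 + j by omega]

/-- **Ohno's sums are the graded pieces of `σ`**: for an index `s` with positive entries and any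
functional `ψ`, `⟨σ(w_s), ψ⟩_{|s|+m} = (-1)^m Σ_{u ∈ Z(s; m)} ψ(w_u)`, `Z(s; m) = MZV.ohnoIndices s m`
(IKZ: `σ_m(x^{k₁-1}y⋯x^{k_n-1}y) = Σ_{e₁+⋯+e_n = m} x^{k₁+e₁-1}y⋯x^{k_n+e_n-1}y`; here `σ` is read at
`u = -1`). [cite: IharaKanekoZagier2006, §6 (σ_m and Ohno's relation)] -/
theorem pair_sigma_binaryWord : ∀ (s : List ℕ), (∀ i ∈ s, 1 ≤ i) → ∀ (m : ℕ) (ψ : List Bool → M),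
    ∑ w ∈ wordsOfLength Bool (MZV.weight s + m),
        subst sigmaSub (monomial (MZV.binaryWord s) 1 : NCSeries Bool ℚ) w • ψ w =
      (-1 : ℚ) ^ m • ((MZV.ohnoIndices s m).map fun u => ψ (MZV.binaryWord u)).sum
  | [], _, m, ψ => by
    rw [MZV.binaryWord, monomial_nil_one, subst_one, MZV.weight_nil, zero_add]
    cases m with
    | zero =>
      rw [MZV.ohnoIndices_nil_zero, List.map_singleton, List.sum_singleton, pow_zero, one_smul, MZV.binaryWord]
      rw [Finset.sum_eq_single_of_mem ([] : List Bool) (mem_wordsOfLength.mpr List.length_nil) fun w hw hne => ?_]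
      · rw [one_apply_nil, one_smul]
      · rw [mem_wordsOfLength, List.length_eq_zero_iff] at hw; exact absurd hw hne
    | succ m =>
      rw [MZV.ohnoIndices_nil_succ, List.map_nil, List.sum_nil, smul_zero]
      refine Finset.sum_eq_zero fun w hw => ?_
      rw [mem_wordsOfLength] at hw
      obtain ⟨b, w', rfl⟩ : ∃ b w', w = b :: w' := by
        cases w with
        | nil => simp at hw
        | cons b w' => exact ⟨b, w', rfl⟩
      rw [one_apply_cons, zero_smul]
  | a :: s, hs, m, ψ => by
    have ha : 1 ≤ a := hs a (by simp)
    have hs' : ∀ i ∈ s, 1 ≤ i := fun i hi => hs i (by simp [hi])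
    have hwt : MZV.weight (a :: s) + m = (a - 1) + 1 + MZV.weight s + m := by
      simp [MZV.weight]; omega
    -- `σ(w_{a s}) = x^{a-1} G₀ y · σ(w_s)`
    have hfac : subst sigmaSub (monomial (MZV.binaryWord (a :: s)) 1 : NCSeries Bool ℚ) =
        letter false ^ (a - 1) * (geom false (-1) * letter true) * subst sigmaSub (monomial (MZV.binaryWord s) 1) := by
      rw [MZV.binaryWord, subst_monomial_append sigmaSub_apply_nil, subst_monomial_append sigmaSub_apply_nil,
        subst_monomial_replicate sigmaSub_apply_nil, show (monomial [true] 1 : NCSeries Bool ℚ) = letter true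
          from rfl, subst_letter sigmaSub_apply_nil]
      rfl
    rw [hwt, hfac, pair_geom_block _ (fun v hv => subst_monomial_apply_eq_zero_of_length_lt sigmaSub_apply_nil
      _ v (by rwa [MZV.length_binaryWord hs'])) ψ m (a - 1)]
    -- inner sums by induction, with the shifted functionals
    have hin : ∀ j ∈ Finset.range (m + 1), (-1 : ℚ) ^ j •
        ∑ w ∈ wordsOfLength Bool (MZV.weight s + (m - j)),
          subst sigmaSub (monomial (MZV.binaryWord s) 1 : NCSeries Bool ℚ) w •
            ψ (List.replicate (a - 1 + j) false ++ [true] ++ w) =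
        (-1 : ℚ) ^ m • ((MZV.ohnoIndices s (m - j)).map fun u => ψ (MZV.binaryWord ((a + j) :: u))).sum := by
      intro j hj
      rw [Finset.mem_range] at hj
      rw [pair_sigma_binaryWord s hs' (m - j) (fun w => ψ (List.replicate (a - 1 + j) false ++ [true] ++ w)),
        smul_smul, ← pow_add, Nat.add_sub_cancel' (by omega : j ≤ m)]
      simp only [replicate_append_binaryWord ha]
    rw [Finset.sum_congr rfl hin, ← Finset.smul_sum, MZV.ohnoIndices_cons, sum_map_flatMap,
      finset_sum_range_eq_list_sum]
    simp only [List.map_map, Function.comp_def]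

end Summit.KontsevichZagierPeriods.FurushoPentagon.DoubleShuffleInKZ
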